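import Mathlib
import HarnessLib
import Summits.AtomisticToContinuum.FouriersLaw.Theses.JunctionLocality
import Literature.MathematicalPhysics.KineticTheory.LangevinChainGibbs

/-!
# Line `thermalise-then-cut-probe-insertion` — checked skeleton for the crux
`JunctionLocality.SuperadditiveResistance` (stmt-AtomisticToContinuum-11748)

Crux (A): along the unique weak-NESS family of `pinnedChain ω₂ lam β γ` (all `> 0`), `T > 0`,
response coefficients `D_N > 0`: `∃ C ∀ N M ≥ 2, R_N + R_M − C ≤ R_{N+M}`, `R_N := (N−1)/D_N`.
Write `G_L := D_L/(L−1)` (two-terminal conductance), `L = N + M`.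

ARCHITECTURE (idea card + triage synthesis "one dissipative-junction device line"). For the split
`(N, M)` the DEVICE is the `(N+M)`-chain with its junction bond `(N−1, N)` KEPT and two extra
Langevin thermostats of the chain's own strength `γ` on the junction momenta `p_{N−1}, p_N`
(terminals `1,2,3,4` = baths on sites `0, N−1, N, N+M−1`). Everything about the device enters
through its EQUILIBRIUM four-terminal linear response at temperature `T`: the symmetric Onsager
conductances `g a b` (`a ≠ b`), whose quadratic form `Σ g_ab (θ_a − θ_b)²` is the entropy
production (≥ 0). With `u := g₀₁ + g₀₂`, `v := g₁₃ + g₂₃` (junction ↔ end-bath transfers),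
`x := g₀₃` (bypass), `a := u + x = L₁₁`, `b := v + x = L₄₄` (end-bath self-conductances), the
merged probe pair FLOATS at first-order temperature `θᶠ := (u − v)/(2(u+v))` and the floating
device conductance is `G_dev := x + u(1/2 − θᶠ) = x + uv/(u+v)`.

* α-LEG (this card's lever, floating form — answers triage objections on `N ≠ M`): for EVERY
  common probe temperature `θ`, the flux out of bath 1 per unit bias, `𝒢₁(θ) = x + u(1/2 − θ)`,
  satisfies the EXACT insertion identity
  `𝒢₁(θ) − G_L = −γ² ⟨S_K ḡ₁, (I − Π_K)(h − θ·e_K)⟩_{μ_T}`,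
  `h` = first-order NESS density of the PLAIN chain (weak solution of `L_T† h = −W`),
  `ḡ₁ = (−L_dev)⁻¹(p_0² − T)` the DEVICE's forward field of the bath-1 energy observable,
  `S_K` = OU operator of the probe pair, `Π_K` = conditional expectation over the two junction
  momenta, `e_K = (p²_{N−1} + p²_N)/(2T²)` (the floating source `θ(W₂ + W₃) = −θγ S_K e_K` is what
  turns the clamped identity (★) of the card into this one). Cauchy–Schwarz, from BOTH ends
  (`ḡ₄`, flux into bath 4), at `θ = θᶠ` where both sides equal `G_dev`:
  `|G_dev − G_L| ≤ γ² · min(‖S_Kḡ₁‖, ‖S_Kḡ₄‖) · v_K(h − θᶠ e_K)^{1/2}`.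
  Bets: `stub_junctionRoughness` (`v_K(h − θᶠe_K) ≤ C₂ G_L²`: junction roughness modulo the
  local-equilibrium shift at the probes' floating temperature — HARDEST) and
  `stub_junctionCurvature` (`‖S_Kḡ₁‖² ≤ C₃ a²`, `‖S_Kḡ₄‖² ≤ C₃ b²`: derivatives only on the
  probed field, at γ-noised coordinates, normalised by the device's own self-conductances).
* β-LEG (companion card double-escape-termination-locality, imported as two stubs): Dirichlet
  principle `G_dev ≤ u(1/2−θ)² + v(1/2+θ)² + x` (proved here from the second law) + the
  ONE-SIDED bets `stub_terminationLocality` (`a ≤ G_N(1 + cG_N)`, `b ≤ G_M(1 + cG_M)`) and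
  `stub_farTransmission` (`0 ≤ x ≤ c G_N G_M`).
* FIXED-N PACKAGE `stub_linearResponse` (existence/uniqueness of the response fields and of the
  device's four-terminal response with its Kubo formulas) and the exact `stub_insertionIdentity`.
* COMPOSITION `SuperadditiveResistance_of` (PROVED, pure real analysis `core_estimate`): with
  `m := min(a,b)`, `K := γ²√(C₂C₃)`: `G_L(1 − Km) ≤ G_dev ≤ U := (aB² + bA² + 2xAB)/(A+B)²`
  (`A := G_N(1+cG_N)`, `B := G_M(1+cG_M)`, trial node temperature `(A−B)/(2(A+B))`), `U ≥ m/2`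
  (uses `x ≥ 0`), hence `R_L ≥ 1/U − 2K ≥ R_N + R_M − 4c − 2K` when `Km ≤ 1/2`, and
  `R_N + R_M ≤ 4K(1+c) + 2` otherwise. NO sign of `u, v`, no M-matrix property, no monotonicity in
  the length and no comparison of `N` with `M` is used: the better of the two ends is selected by
  `min(a, b)` and paid for by the Dirichlet value `U ≥ m/2`.

Disproof.lean (cdisprove seat, evidence 20260815T224245Z; file not mounted in this seat, used via
its evidence notes): §1 `WithoutDynamics` shell FALSE — honoured: all content sits in the six
dynamical stubs, the composition is pure algebra over their outputs; §3 harmonic-corner tightness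
(`C ≥ 1/fluxLimit`) — consistent: every bet is RELATIVE (`O(G²)` in conductance), so at
`lam = β = 0` (outside the crux's box anyway) the skeleton yields an `O(1)` constant, never `C → 0`;
§2/§2b doubling-defect kill statistic and §4(iii) `lam = 0` log edge — the bets
`stub_junctionRoughness`/`stub_terminationLocality` are exactly where bounded mean free path
(pinning, `lam, β > 0`) must enter. No `_false_without_` theorem names a hypothesis H beyond "the
dynamics"; no landed `Negative/` lemma exists for this crux (`ledger negatives`: none on this decl).
-/

noncomputable section

open MeasureTheory Filter Topology ProbabilityTheory
open scoped ContDiff NNReal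
open Literature.MathematicalPhysics.KineticTheory.HeatConduction

namespace Summit.AtomisticToContinuum.FouriersLaw.Cruxes.SuperadditiveResistance.ThermaliseThenCutProbeInsertion

/-! ## Device vocabulary (local definitions over the tree's `OscillatorChain` API) -/

/-- `p_s²` of site `s` (as a `Fin`-proof-free sum; `0` if `s ≥ L`). -/
def kin (L s : ℕ) (x : PhaseSpace L) : ℝ :=
  ∑ i : Fin L, if i.val = s then x.2 i ^ 2 else 0

/-- Ornstein–Uhlenbeck thermostat of temperature `θ` (strength 1) acting on the momentum `p_s`:
`θ ∂²_{p_s} f − p_s ∂_{p_s} f`. -/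
def thermo (L s : ℕ) (θ : ℝ) (f : PhaseSpace L → ℝ) (x : PhaseSpace L) : ℝ :=
  ∑ i : Fin L, if i.val = s then θ * partialP i (partialP i f) x - x.2 i * partialP i f x else 0

/-- Terminal sites of the device for the split `(N, M)`: terminals `0,1,2,3` (= baths 1,2,3,4 of
the card) sit on sites `0, N−1, N, N+M−1`. -/
def termSite (N M : ℕ) : Fin 4 → ℕ := ![0, N - 1, N, N + M - 1]

variable (P : OscillatorChain)

/-- Generator of the DEVICE: the `(N+M)`-chain `P` between its end baths (temperatures `τ 0`,
`τ 3`) with two additional Langevin thermostats of the chain's own strength `P.γ` on the junction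
momenta `p_{N−1}` (temperature `τ 1`) and `p_N` (temperature `τ 2`); the junction bond is kept. -/
def deviceGenerator (N M : ℕ) (τ : Fin 4 → ℝ) (f : PhaseSpace (N + M) → ℝ)
    (x : PhaseSpace (N + M)) : ℝ :=
  P.generator (N + M) (τ 0) (τ 3) f x +
    P.γ * (thermo (N + M) (N - 1) (τ 1) f x + thermo (N + M) N (τ 2) f x)

/-- Weak steady states of the device (same weak Fokker–Planck class as
`OscillatorChain.IsSteadyState`, with finite kinetic temperatures so that the four bath powers
`γ(τ_a − ⟨p_a²⟩)` are expectations). -/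
def IsDeviceSteadyState (N M : ℕ) (τ : Fin 4 → ℝ) (μ : Measure (PhaseSpace (N + M))) : Prop :=
  IsProbabilityMeasure μ ∧
    (∀ f : PhaseSpace (N + M) → ℝ, ContDiff ℝ ∞ f → HasCompactSupport f →
      ∫ x, deviceGenerator P N M τ f x ∂μ = 0) ∧
    ∀ s : ℕ, Integrable (kin (N + M) s) μ

/-! ## Four-terminal Onsager algebra (pure real; `g a b`, `a ≠ b`, the transfer conductances) -/

section OnsagerAlgebra

/-- Entropy-production quadratic form `Σ_a Σ_b g_ab (θ_a − θ_b)²` of the linearised powers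
`J_a = Σ_b g_ab (θ_a − θ_b)`. -/
def dirichletForm (g : Fin 4 → Fin 4 → ℝ) (θ : Fin 4 → ℝ) : ℝ :=
  ∑ a, ∑ b, g a b * (θ a - θ b) ^ 2

/-- `u`: transfer conductance junction pair → bath 1 (terminal 0). -/
def transferLeft (g : Fin 4 → Fin 4 → ℝ) : ℝ := g 0 1 + g 0 2
/-- `v`: transfer conductance junction pair → bath 4 (terminal 3). -/
def transferRight (g : Fin 4 → Fin 4 → ℝ) : ℝ := g 1 3 + g 2 3
/-- `x`: bypass (direct bath 4 → bath 1 transfer past the thermostatted pair). -/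
def bypass (g : Fin 4 → Fin 4 → ℝ) : ℝ := g 0 3
/-- `a = L₁₁`: self-conductance of bath 1 in the device. -/
def selfLeft (g : Fin 4 → Fin 4 → ℝ) : ℝ := g 0 1 + g 0 2 + g 0 3
/-- `b = L₄₄`: self-conductance of bath 4 in the device. -/
def selfRight (g : Fin 4 → Fin 4 → ℝ) : ℝ := g 0 3 + g 1 3 + g 2 3
/-- `θᶠ`: first-order floating temperature of the merged probe pair (zero net uptake). -/
def floatTemp (g : Fin 4 → Fin 4 → ℝ) : ℝ :=
  (transferLeft g - transferRight g) / (2 * (transferLeft g + transferRight g))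
/-- `𝒢₁(θ)`: flux OUT of bath 1 per unit total bias when both probes sit at first-order
temperature `θ` (bias `+1/2` on bath 1, `−1/2` on bath 4). -/
def sideOne (g : Fin 4 → Fin 4 → ℝ) (θ : ℝ) : ℝ := bypass g + transferLeft g * (1 / 2 - θ)
/-- `𝒢₄(θ)`: flux INTO bath 4 per unit total bias in the same configuration. -/
def sideFour (g : Fin 4 → Fin 4 → ℝ) (θ : ℝ) : ℝ := bypass g + transferRight g * (1 / 2 + θ)
/-- `G_dev = 𝒢₁(θᶠ)`: two-terminal conductance of the device with the probe pair floating. -/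
def deviceConductance (g : Fin 4 → Fin 4 → ℝ) : ℝ := sideOne g (floatTemp g)

variable {g : Fin 4 → Fin 4 → ℝ}

theorem dirichletForm_eq (hsym : ∀ a b, g a b = g b a) (θ : Fin 4 → ℝ) :
    dirichletForm g θ = 2 * (g 0 1 * (θ 0 - θ 1) ^ 2 + g 0 2 * (θ 0 - θ 2) ^ 2 +
      g 0 3 * (θ 0 - θ 3) ^ 2 + g 1 2 * (θ 1 - θ 2) ^ 2 + g 1 3 * (θ 1 - θ 3) ^ 2 +
      g 2 3 * (θ 2 - θ 3) ^ 2) := by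
  simp only [dirichletForm, Fin.sum_univ_four]
  rw [hsym 1 0, hsym 2 0, hsym 3 0, hsym 2 1, hsym 3 1, hsym 3 2]
  ring

theorem selfLeft_nonneg (hsym : ∀ a b, g a b = g b a) (hpsd : ∀ θ, 0 ≤ dirichletForm g θ) :
    0 ≤ selfLeft g := by
  have h := hpsd ![1, 0, 0, 0]
  rw [dirichletForm_eq hsym] at h
  simp at h
  unfold selfLeft
  linarith

theorem selfRight_nonneg (hsym : ∀ a b, g a b = g b a) (hpsd : ∀ θ, 0 ≤ dirichletForm g θ) :
    0 ≤ selfRight g := by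
  have h := hpsd ![0, 0, 0, 1]
  rw [dirichletForm_eq hsym] at h
  simp at h
  unfold selfRight
  linarith

theorem transfer_sum_nonneg (hsym : ∀ a b, g a b = g b a) (hpsd : ∀ θ, 0 ≤ dirichletForm g θ) :
    0 ≤ transferLeft g + transferRight g := by
  have h := hpsd ![0, 1, 1, 0]
  rw [dirichletForm_eq hsym] at h
  simp at h
  unfold transferLeft transferRight
  linarith

/-- In a PSD form a vanishing diagonal entry kills its row: `u + v = 0 ⇒ u = 0`. -/
theorem transferLeft_eq_zero (hsym : ∀ a b, g a b = g b a) (hpsd : ∀ θ, 0 ≤ dirichletForm g θ)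
    (h0 : transferLeft g + transferRight g = 0) : transferLeft g = 0 := by
  by_contra hu
  have key : ∀ t : ℝ, 0 ≤ transferLeft g - 2 * transferLeft g * t + bypass g := by
    intro t
    have h := hpsd ![1, t, t, 0]
    rw [dirichletForm_eq hsym] at h
    simp at h
    have hv : g 1 3 + g 2 3 = -(g 0 1 + g 0 2) := by
      unfold transferLeft transferRight at h0; linarith
    unfold transferLeft bypass
    nlinarith [hv]
  have h1 := key ((transferLeft g + bypass g + 1) / (2 * transferLeft g))
  have h2 : 2 * transferLeft g * ((transferLeft g + bypass g + 1) / (2 * transferLeft g)) =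
      transferLeft g + bypass g + 1 := by
    field_simp
  linarith

/-- DIRICHLET PRINCIPLE for the floating node (from the second law only): the floating device
conductance is below the entropy production of every trial node temperature `θ`. -/
theorem deviceConductance_le (hsym : ∀ a b, g a b = g b a) (hpsd : ∀ θ, 0 ≤ dirichletForm g θ)
    (θ : ℝ) :
    deviceConductance g ≤ (selfLeft g - bypass g) * (1 / 2 - θ) ^ 2 +
      (selfRight g - bypass g) * (1 / 2 + θ) ^ 2 + bypass g := by
  have hu : selfLeft g - bypass g = transferLeft g := by unfold selfLeft bypass transferLeft; ring
  have hv : selfRight g - bypass g = transferRight g := by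
    unfold selfRight bypass transferRight; ring
  rw [hu, hv]
  unfold deviceConductance sideOne floatTemp
  rcases (transfer_sum_nonneg hsym hpsd).eq_or_lt with h0 | hpos
  · have hu0 : transferLeft g = 0 := transferLeft_eq_zero hsym hpsd h0.symm
    have hv0 : transferRight g = 0 := by linarith
    simp [hu0, hv0]
  · have hne : transferLeft g + transferRight g ≠ 0 := ne_of_gt hpos
    have key : transferLeft g * (1 / 2 - θ) ^ 2 + transferRight g * (1 / 2 + θ) ^ 2 + bypass g -
        (bypass g + transferLeft g *
          (1 / 2 - (transferLeft g - transferRight g) / (2 * (transferLeft g + transferRight g)))) =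
        (transferLeft g * (1 / 2 - θ) - transferRight g * (1 / 2 + θ)) ^ 2 /
          (transferLeft g + transferRight g) := by
      field_simp
      ring
    have hnn : 0 ≤ (transferLeft g * (1 / 2 - θ) - transferRight g * (1 / 2 + θ)) ^ 2 /
        (transferLeft g + transferRight g) := div_nonneg (sq_nonneg _) hpos.le
    linarith

/-- Both ends see the same current when the pair floats: `𝒢₄(θᶠ) = 𝒢₁(θᶠ) = G_dev`. -/
theorem sideFour_floatTemp (hsym : ∀ a b, g a b = g b a) (hpsd : ∀ θ, 0 ≤ dirichletForm g θ) :
    sideFour g (floatTemp g) = deviceConductance g := by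
  unfold deviceConductance sideOne sideFour floatTemp
  rcases (transfer_sum_nonneg hsym hpsd).eq_or_lt with h0 | hpos
  · have hu0 : transferLeft g = 0 := transferLeft_eq_zero hsym hpsd h0.symm
    have hv0 : transferRight g = 0 := by linarith
    simp [hu0, hv0]
  · have hne : transferLeft g + transferRight g ≠ 0 := ne_of_gt hpos
    field_simp
    ring

end OnsagerAlgebra

/-! ## The real-analysis core of the composition -/

/-- CORE ESTIMATE. `gN, gM, gL`: conductances of the pieces and of the whole; `a, b, x`: device
self-conductances and bypass; `Gd`: floating device conductance. Hypotheses: the β-leg one-sided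
bounds (`a ≤ gN(1+c·gN)`, `b ≤ gM(1+c·gM)`, `0 ≤ x ≤ c·gN·gM`), the α-leg insertion bound
`gL − Gd ≤ K·min(a,b)·gL`, and the Dirichlet principle. Conclusion: the crux inequality with an
explicit constant depending on `c, K` only. -/
theorem core_estimate {gN gM gL a b x Gd K c : ℝ} (hGN : 0 < gN) (hGM : 0 < gM) (hGL : 0 < gL)
    (hK : 0 ≤ K) (hc : 0 ≤ c) (ha0 : 0 ≤ a) (hb0 : 0 ≤ b) (hx0 : 0 ≤ x)
    (ha : a ≤ gN * (1 + c * gN)) (hb : b ≤ gM * (1 + c * gM)) (hx : x ≤ c * gN * gM)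
    (hα : gL - Gd ≤ K * min a b * gL)
    (hDir : ∀ θ : ℝ, Gd ≤ (a - x) * (1 / 2 - θ) ^ 2 + (b - x) * (1 / 2 + θ) ^ 2 + x) :
    1 / gN + 1 / gM - (4 * c + 2 * K + 4 * K * (1 + c) + 2) ≤ 1 / gL := by
  have ha' := ha
  have hb' := hb
  -- name the composite quantities (opaque variables keep the terms small)
  obtain ⟨A, hA⟩ : ∃ A : ℝ, A = gN * (1 + c * gN) := ⟨_, rfl⟩
  obtain ⟨B, hB⟩ : ∃ B : ℝ, B = gM * (1 + c * gM) := ⟨_, rfl⟩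
  obtain ⟨X, hX⟩ : ∃ X : ℝ, X = c * gN * gM := ⟨_, rfl⟩
  obtain ⟨m, hm⟩ : ∃ m : ℝ, m = min a b := ⟨_, rfl⟩
  rw [← hA] at ha
  rw [← hB] at hb
  rw [← hX] at hx
  rw [← hm] at hα
  have hA0 : 0 < A := by rw [hA]; positivity
  have hB0 : 0 < B := by rw [hB]; positivity
  have hX0 : 0 ≤ X := by rw [hX]; positivity
  have hm0 : 0 ≤ m := by rw [hm]; exact le_min ha0 hb0
  have hma : m ≤ a := by rw [hm]; exact min_le_left a b
  have hmb : m ≤ b := by rw [hm]; exact min_le_right a b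
  have hgNA : gN ≤ A := by rw [hA]; nlinarith [mul_nonneg hc (mul_pos hGN hGN).le]
  have hgMB : gM ≤ B := by rw [hB]; nlinarith [mul_nonneg hc (mul_pos hGM hGM).le]
  have hGLinv : 0 < 1 / gL := by positivity
  -- reciprocal bounds for the pieces
  have hinvA : 1 / gN - c ≤ 1 / A := by
    have e : 1 / A = 1 / gN - c / (1 + c * gN) := by
      rw [hA]
      field_simp
      ring
    rw [e]
    have : c / (1 + c * gN) ≤ c := div_le_self hc (by nlinarith [mul_nonneg hc hGN.le])
    linarith
  have hinvB : 1 / gM - c ≤ 1 / B := by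
    have e : 1 / B = 1 / gM - c / (1 + c * gM) := by
      rw [hB]
      field_simp
      ring
    rw [e]
    have : c / (1 + c * gM) ≤ c := div_le_self hc (by nlinarith [mul_nonneg hc hGM.le])
    linarith
  -- a short piece has small resistance
  have hshort : ∀ {G s κ : ℝ}, 0 < G → s ≤ G * (1 + c * G) → 0 < κ → κ < s →
      1 / G ≤ (1 + c) / κ + 1 := by
    intro G s κ hG hs hκ hκs
    have hpos : 0 ≤ (1 + c) / κ := by positivity
    rcases le_or_gt 1 G with hG1 | hG1
    · have h1 : 1 / G ≤ 1 := by rw [div_le_one hG]; exact hG1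
      linarith
    · have h3 : G * (1 + c * G) ≤ G * (1 + c) := by
        apply mul_le_mul_of_nonneg_left _ hG.le
        nlinarith [mul_le_mul_of_nonneg_left hG1.le hc]
      have h4 : κ < G * (1 + c) := by linarith
      have h5 : 1 / G ≤ (1 + c) / κ := by
        rw [div_le_div_iff₀ hG hκ]
        linarith
      linarith
  by_cases hreg : K * m ≤ 1 / 2
  · -- NON-TRIVIAL REGIME
    have hAB : 0 < A + B := by positivity
    obtain ⟨U, hUdef⟩ :
        ∃ U : ℝ, U = (a * B ^ 2 + b * A ^ 2 + 2 * x * A * B) / (A + B) ^ 2 := ⟨_, rfl⟩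
    -- the Dirichlet value at the trial node temperature θ₀ = (A − B)/(2(A+B)) is U
    have hUeq : (a - x) * (1 / 2 - (A - B) / (2 * (A + B))) ^ 2 +
        (b - x) * (1 / 2 + (A - B) / (2 * (A + B))) ^ 2 + x = U := by
      rw [hUdef]
      field_simp
      ring
    have hGdU : Gd ≤ U := by rw [← hUeq]; exact hDir _
    -- U ≥ m/2 (uses x ≥ 0)
    have hUm : m / 2 ≤ U := by
      rw [hUdef, div_le_div_iff₀ (by norm_num : (0:ℝ) < 2) (by positivity)]
      have h1 : m * B ^ 2 ≤ a * B ^ 2 := mul_le_mul_of_nonneg_right hma (sq_nonneg B)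
      have h2 : m * A ^ 2 ≤ b * A ^ 2 := mul_le_mul_of_nonneg_right hmb (sq_nonneg A)
      have h3 : 0 ≤ 2 * x * A * B := by positivity
      have h4 : 0 ≤ m * (A - B) ^ 2 := mul_nonneg hm0 (sq_nonneg (A - B))
      linarith
    -- U ≤ A B (A + B + 2X)/(A+B)²  (uses only the UPPER bounds on a, b, x)
    have hUup : U ≤ A * B * (A + B + 2 * X) / (A + B) ^ 2 := by
      rw [hUdef]
      apply div_le_div_of_nonneg_right _ (by positivity)
      have h1 : a * B ^ 2 ≤ A * B ^ 2 := mul_le_mul_of_nonneg_right ha (sq_nonneg B)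
      have h2 : b * A ^ 2 ≤ B * A ^ 2 := mul_le_mul_of_nonneg_right hb (sq_nonneg A)
      have hAB' : 0 ≤ 2 * A * B := by positivity
      have h3 : 2 * A * B * x ≤ 2 * A * B * X := mul_le_mul_of_nonneg_left hx hAB'
      linarith
    -- α-leg: gL (1 − K m) ≤ Gd ≤ U
    have h1 : gL * (1 - K * m) ≤ U := by linarith
    have hUpos : 0 < U := by
      have : 0 < gL * (1 - K * m) := mul_pos hGL (by linarith)
      linarith
    have h2 : (1 - K * m) / U ≤ 1 / gL := by
      rw [div_le_div_iff₀ hUpos hGL]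
      linarith
    have h3 : 1 / U - 2 * K ≤ (1 - K * m) / U := by
      have h31 : K * m / U ≤ 2 * K := by
        rw [div_le_iff₀ hUpos]
        have : K * m ≤ K * (2 * U) := mul_le_mul_of_nonneg_left (by linarith) hK
        linarith
      have h32 : (1 - K * m) / U = 1 / U - K * m / U := by rw [sub_div]
      linarith
    -- β-leg: 1/U ≥ (A+B)²/(AB(A+B+2X)) ≥ 1/A + 1/B − 2X/(AB) ≥ 1/gN + 1/gM − 4c
    have h4 : (A + B) ^ 2 / (A * B * (A + B + 2 * X)) ≤ 1 / U := by
      have := one_div_le_one_div_of_le hUpos hUup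
      rw [one_div_div] at this
      exact this
    have h5 : (A + B - 2 * X) / (A * B) ≤ (A + B) ^ 2 / (A * B * (A + B + 2 * X)) := by
      rw [div_le_div_iff₀ (by positivity) (by positivity)]
      have hAB2 : 0 ≤ A * B * X ^ 2 := by positivity
      linarith
    have h6 : 1 / gN + 1 / gM - 4 * c ≤ (A + B - 2 * X) / (A * B) := by
      have hX' : 2 * X / (A * B) ≤ 2 * c := by
        rw [div_le_iff₀ (by positivity), hX]
        have : gN * gM ≤ A * B := mul_le_mul hgNA hgMB hGM.le hA0.le
        have hc2 : (0:ℝ) ≤ 2 * c := by positivity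
        have := mul_le_mul_of_nonneg_left this hc2
        linarith
      have hsplit : (A + B - 2 * X) / (A * B) = 1 / A + 1 / B - 2 * X / (A * B) := by
        field_simp
        ring
      rw [hsplit]
      linarith
    have hK' : 0 ≤ 4 * K * (1 + c) + 2 := by positivity
    linarith
  · -- TRIVIAL REGIME: both pieces are short
    push Not at hreg
    have hKpos : 0 < K := by
      rcases hK.eq_or_lt with h | h
      · rw [← h] at hreg; linarith
      · exact h
    have hmpos : 1 / (2 * K) < m := by
      rw [div_lt_iff₀ (by positivity)]
      linarith
    have hκ : 0 < 1 / (2 * K) := by positivity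
    have hN' := hshort hGN ha' hκ (lt_of_lt_of_le hmpos hma)
    have hM' := hshort hGM hb' hκ (lt_of_lt_of_le hmpos hmb)
    have hsimp : (1 + c) / (1 / (2 * K)) = 2 * K * (1 + c) := by
      field_simp
    rw [hsimp] at hN' hM'
    linarith

/-! ## Junction analysis objects (the α-leg's vocabulary) -/

/-- `S_K`: the Ornstein–Uhlenbeck operator (temperature `T`, unit strength) of the probe pair,
acting on the junction momenta `p_{N−1}, p_N`; `μ_T`-symmetric, `≤ 0`, kernel = functions of
everything but `p_{N−1}, p_N`. The device generator at equilibrium is `L_T + γ S_K`. -/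
def junctionOU (T : ℝ) (N M : ℕ) (f : PhaseSpace (N + M) → ℝ) (x : PhaseSpace (N + M)) : ℝ :=
  thermo (N + M) (N - 1) T f x + thermo (N + M) N T f x

/-- `Π_K f`: average of `f` over the two junction momenta redrawn from the Maxwellian `N(0, T)`
(the conditional expectation given everything but `p_{N−1}, p_N` under the Gibbs state, whose
momenta are i.i.d. `N(0,T)` and independent of the positions). -/
def condK (T : ℝ) (N M : ℕ) (f : PhaseSpace (N + M) → ℝ) (x : PhaseSpace (N + M)) : ℝ :=
  ∫ ξ : Fin (N + M) → ℝ, f (x.1, fun i => if i.val = N - 1 ∨ i.val = N then ξ i else x.2 i)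
    ∂(Measure.pi fun _ : Fin (N + M) => gaussianReal 0 (Real.toNNReal T))

/-- `v_K(f) = ‖(I − Π_K) f‖²_{L²(μ_T)} = E Var(f | everything but p_{N−1}, p_N)`: the JUNCTION
ROUGHNESS of `f` (an oscillation quantity: no derivative of `f` is taken). -/
def roughness (T : ℝ) (N M : ℕ) (f : PhaseSpace (N + M) → ℝ) : ℝ :=
  ∫ x, (f x - condK T N M f x) ^ 2 ∂(P.gibbsMeasure (N + M) T)

/-- `e_K = (p²_{N−1} + p²_N)/(2T²)`: the local-equilibrium (Gibbs-shift) direction of the pair;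
`W₂ + W₃ = −γ S_K e_K` is the identity that makes the floating form of (★) exact. -/
def eK (T : ℝ) (N M : ℕ) (x : PhaseSpace (N + M)) : ℝ :=
  (kin (N + M) (N - 1) x + kin (N + M) N x) / (2 * T ^ 2)

/-- `‖S_K f‖²_{L²(μ_T)}`: the JUNCTION CURVATURE of `f` (two `p`-derivatives, taken only on the
PROBED device's fields, at the `γ`-noised coordinates). -/
def curvature (T : ℝ) (N M : ℕ) (f : PhaseSpace (N + M) → ℝ) : ℝ :=
  ∫ x, (junctionOU T N M f x) ^ 2 ∂(P.gibbsMeasure (N + M) T)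

/-! ## Frames: what the fixed-`N` package hands to the analytic stubs -/

/-- `W = (γ/2T²)(p_0² − p_{L−1}²)`: first-order source of the plain `L`-chain under the bias
`T ± δ/2` (Gaussian integration by parts of `(γ/2)(∂²_{p_0} − ∂²_{p_{L−1}})` against `μ_T`). -/
def plainSource (T : ℝ) (L : ℕ) (x : PhaseSpace L) : ℝ :=
  P.γ / (2 * T ^ 2) * (kin L 0 x - kin L (L - 1) x)

/-- `h` is A first-order NESS density of the plain `L`-chain at `T` w.r.t. the Gibbs state:
mean zero, `L²(μ_T)`, weak solution of `L_T† h = −W` tested on `C_c^∞`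
(`∫ (L_T f) h dμ_T = −∫ f W dμ_T`). -/
def IsPlainResponseField (T : ℝ) (L : ℕ) (h : PhaseSpace L → ℝ) : Prop :=
  MemLp h 2 (P.gibbsMeasure L T) ∧ ∫ x, h x ∂(P.gibbsMeasure L T) = 0 ∧
    ∀ f : PhaseSpace L → ℝ, ContDiff ℝ ∞ f → HasCompactSupport f →
      ∫ x, P.generator L T T f x * h x ∂(P.gibbsMeasure L T) =
        -∫ x, f x * plainSource P T L x ∂(P.gibbsMeasure L T)

/-- PLAIN FRAME: `h` is THE response field (unique a.e. in its class) and `G` is the two-terminal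
conductance it represents through the bath-1 power: `G = γ(1/2 − ⟨p_0² − T, h⟩_{μ_T})`
(in the line `G := D_L/(L−1)` of the crux's own response coefficients). -/
def PlainFrame (T : ℝ) (L : ℕ) (h : PhaseSpace L → ℝ) (G : ℝ) : Prop :=
  IsPlainResponseField P T L h ∧
    (∀ h', IsPlainResponseField P T L h' → h' =ᵐ[P.gibbsMeasure L T] h) ∧
    G = P.γ * (1 / 2 - ∫ x, (kin L 0 x - T) * h x ∂(P.gibbsMeasure L T))

/-- `gb` is the equilibrium device's FORWARD FIELD of the energy observable of the bath on site
`s`: `gb = (−L_dev)⁻¹ (p_s² − T)` as a classical `C²` solution of `L_dev gb = −(p_s² − T)`, mean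
zero, in `L²(μ_T)` together with `S_K gb`. -/
def IsForwardField (T : ℝ) (N M : ℕ) (s : ℕ) (gb : PhaseSpace (N + M) → ℝ) : Prop :=
  ContDiff ℝ 2 gb ∧ MemLp gb 2 (P.gibbsMeasure (N + M) T) ∧
    MemLp (junctionOU T N M gb) 2 (P.gibbsMeasure (N + M) T) ∧
    ∫ x, gb x ∂(P.gibbsMeasure (N + M) T) = 0 ∧
    ∀ x, deviceGenerator P N M (fun _ => T) gb x = -(kin (N + M) s x - T)

/-- DEVICE FRAME for the split `(N, M)` at temperature `T`: (i) weak steady states of the device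
exist and are unique for positive terminal temperatures; (ii) `g` is the symmetric (Onsager)
matrix of transfer conductances, with non-negative entropy-production form, and it IS the
linear response of the four bath powers `γ(τ_a − ⟨p_a²⟩)` at equilibrium along every direction
`θ`; (iii) `gb₁, gb₄` are the (unique) forward fields of the two END baths and the row-`1` /
row-`4` conductances are given by their Kubo formulas
`g_{1b} = (γ²/T²)⟨gb₁, p_b² − T⟩` (`b ≠ 1`), `L₁₁ = γ − (γ²/T²)⟨gb₁, p_0² − T⟩` (and likewise at
bath 4). Terminals `0,1,2,3` ↦ sites `0, N−1, N, N+M−1`. -/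
def DeviceFrame (T : ℝ) (N M : ℕ) (g : Fin 4 → Fin 4 → ℝ)
    (gb₁ gb₄ : PhaseSpace (N + M) → ℝ) : Prop :=
  (∀ τ : Fin 4 → ℝ, (∀ a, 0 < τ a) → ∃ μ, IsDeviceSteadyState P N M τ μ) ∧
  (∀ τ : Fin 4 → ℝ, (∀ a, 0 < τ a) → ∀ μ μ' : Measure (PhaseSpace (N + M)),
      IsDeviceSteadyState P N M τ μ → IsDeviceSteadyState P N M τ μ' → μ = μ') ∧
  (∀ a b, g a b = g b a) ∧
  (∀ θ, 0 ≤ dirichletForm g θ) ∧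
  (∀ (θ : Fin 4 → ℝ) (ν : ℝ → Measure (PhaseSpace (N + M))),
      (∀ ε : ℝ, (∀ a, 0 < T + ε * θ a) →
        IsDeviceSteadyState P N M (fun a => T + ε * θ a) (ν ε)) →
      ∀ a : Fin 4, Tendsto (fun ε : ℝ =>
          P.γ * ((T + ε * θ a) - ∫ x, kin (N + M) (termSite N M a) x ∂(ν ε)) / ε)
        (𝓝[≠] 0) (𝓝 (∑ b, g a b * (θ a - θ b)))) ∧
  IsForwardField P T N M 0 gb₁ ∧ (∀ gb, IsForwardField P T N M 0 gb → gb = gb₁) ∧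
  IsForwardField P T N M (N + M - 1) gb₄ ∧
    (∀ gb, IsForwardField P T N M (N + M - 1) gb → gb = gb₄) ∧
  (∀ b : Fin 4, b ≠ 0 → g 0 b = P.γ ^ 2 / T ^ 2 *
      ∫ x, gb₁ x * (kin (N + M) (termSite N M b) x - T) ∂(P.gibbsMeasure (N + M) T)) ∧
  selfLeft g = P.γ - P.γ ^ 2 / T ^ 2 *
      ∫ x, gb₁ x * (kin (N + M) 0 x - T) ∂(P.gibbsMeasure (N + M) T) ∧
  (∀ b : Fin 4, b ≠ 3 → g 3 b = P.γ ^ 2 / T ^ 2 *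
      ∫ x, gb₄ x * (kin (N + M) (termSite N M b) x - T) ∂(P.gibbsMeasure (N + M) T)) ∧
  selfRight g = P.γ - P.γ ^ 2 / T ^ 2 *
      ∫ x, gb₄ x * (kin (N + M) (N + M - 1) x - T) ∂(P.gibbsMeasure (N + M) T)

/-- CRUX FRAME: the hypotheses of `SuperadditiveResistance` on `(ω₂, lam, β, γ, μ, T, D)`
bundled — parameters positive, weak-NESS uniqueness, `μ` a steady-state family, `T > 0`, `D` its
response coefficients with `D_N > 0` for `N ≥ 2`. -/
def CruxFrame (ω₂ lam β γ : ℝ) (μ : (N : ℕ) → ℝ → ℝ → Measure (PhaseSpace N)) (T : ℝ)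
    (D : ℕ → ℝ) : Prop :=
  0 < ω₂ ∧ 0 < lam ∧ 0 < β ∧ 0 < γ ∧
  (∀ (N : ℕ) (T_L T_R : ℝ), 0 < T_L → 0 < T_R → ∀ μ' ν : Measure (PhaseSpace N),
      (pinnedChain ω₂ lam β γ).IsSteadyState N T_L T_R μ' →
      (pinnedChain ω₂ lam β γ).IsSteadyState N T_L T_R ν → μ' = ν) ∧
  (∀ (N : ℕ) (T_L T_R : ℝ), 0 < T_L → 0 < T_R →
      (pinnedChain ω₂ lam β γ).IsSteadyState N T_L T_R (μ N T_L T_R)) ∧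
  0 < T ∧
  (∀ N : ℕ, Tendsto (fun δ : ℝ =>
      (pinnedChain ω₂ lam β γ).totalCurrent (μ N (T + δ / 2) (T - δ / 2)) / δ)
      (𝓝[≠] 0) (𝓝 (D N))) ∧
  (∀ N : ℕ, 2 ≤ N → 0 < D N)

/-! ## The registered stubs -/

/-- STUB 0 — FIXED-`N` LINEAR-RESPONSE PACKAGE (size L; fixed-N toolbox, not a bet).
For every length `L ≥ 2` the plain chain's first-order NESS density `h_L` exists, is unique a.e.
in `L²(μ_T)`, and represents the crux's response coefficient, `D_L/(L−1) = γ(1/2 − ⟨p_0²−T, h_L⟩)`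
(finite-volume Kubo formula, Rey-Bellet 2003 Rem. 4.4; Kundu–Dhar–Narayan 2009); for every split
`(N, M)` the γ-probed device has unique weak steady states near equilibrium, a differentiable
four-terminal response with symmetric Onsager matrix and non-negative entropy production, and
unique forward fields of the two end baths with their Kubo formulas (network version of
Cuneo–Eckmann–Hairer–Rey-Bellet 2018 Thm 2.13 + Carmona 2007 + Hairer–Majda 2009; Onsager symmetry
from the momentum-reversal symmetry of `μ_T`, Eckmann–Pillet–Rey-Bellet 1999). Each conjunct is a
`--supports` lemma of its own. -/
theorem stub_linearResponse :
    ∀ (ω₂ lam β γ : ℝ) (μ : (N : ℕ) → ℝ → ℝ → Measure (PhaseSpace N)) (T : ℝ) (D : ℕ → ℝ),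
      CruxFrame ω₂ lam β γ μ T D →
      (∀ L : ℕ, 2 ≤ L → ∃ h : PhaseSpace L → ℝ,
          PlainFrame (pinnedChain ω₂ lam β γ) T L h (D L / ((L : ℝ) - 1))) ∧
      (∀ N M : ℕ, 2 ≤ N → 2 ≤ M →
        ∃ (g : Fin 4 → Fin 4 → ℝ) (gb₁ gb₄ : PhaseSpace (N + M) → ℝ),
          DeviceFrame (pinnedChain ω₂ lam β γ) T N M g gb₁ gb₄) := by
  sorry

/-- STUB 1 — THE INSERTION IDENTITY, floating form, from both ends (size M–L; exact at fixed N).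
For every common first-order probe temperature `θ`:
`𝒢₁(θ) − G = −γ² ⟨S_K gb₁, (I − Π_K)(h − θ e_K)⟩_{μ_T}` and
`𝒢₄(θ) − G = +γ² ⟨S_K gb₄, (I − Π_K)(h − θ e_K)⟩_{μ_T}`, hence by Cauchy–Schwarz the two squared
inequalities below. Proof content: resolvent identity `(−L_dev†)⁻¹ − (−L_T†)⁻¹` for two
`μ_T`-preserving generators, `W₂ + W₃ = −γ S_K e_K`, `S_K` symmetric with `S_K Π_K = 0`, the sum
rule `Σ_b ⟨gb₁, p_b² − T⟩ = T²/γ`, plus the domain bookkeeping (`gb` is smooth but not compactly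
supported, `h` is only `L²`: approximate in the graph norm with Lyapunov weights). -/
theorem stub_insertionIdentity :
    ∀ (ω₂ lam β γ T : ℝ), 0 < ω₂ → 0 < lam → 0 < β → 0 < γ → 0 < T →
      ∀ (N M : ℕ), 2 ≤ N → 2 ≤ M →
      ∀ (h : PhaseSpace (N + M) → ℝ) (G : ℝ) (g : Fin 4 → Fin 4 → ℝ)
        (gb₁ gb₄ : PhaseSpace (N + M) → ℝ),
        PlainFrame (pinnedChain ω₂ lam β γ) T (N + M) h G →
        DeviceFrame (pinnedChain ω₂ lam β γ) T N M g gb₁ gb₄ →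
        ∀ θ : ℝ,
          (sideOne g θ - G) ^ 2 ≤ γ ^ 4 * curvature (pinnedChain ω₂ lam β γ) T N M gb₁ *
              roughness (pinnedChain ω₂ lam β γ) T N M (fun x => h x - θ * eK T N M x) ∧
          (sideFour g θ - G) ^ 2 ≤ γ ^ 4 * curvature (pinnedChain ω₂ lam β γ) T N M gb₄ *
              roughness (pinnedChain ω₂ lam β γ) T N M (fun x => h x - θ * eK T N M x) := by
  sorry

/-- STUB 2 — JUNCTION ROUGHNESS MODULO LOCAL EQUILIBRIUM (size XL; THE BET, hardest stub).
`v_K(h − θᶠ e_K) ≤ C₂ G_L²` for every split: conditionally on everything but the two junction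
momenta, the plain chain's first-order NESS density is a Gibbs shift at the probes' FLOATING
temperature plus a fluctuation of size `O(G_L)` (the current mode; exact floor
`v_K ≥ 2G_L²/(T·E V′(r)²)`). By Pythagoras it splits into (2a) `v_K(h − θ* e_K) ≤ C G_L²` with
`θ* = (τ_{N−1} + τ_N)/2` the plain chain's own first-order kinetic temperature at the pair
(roughness modulo LTE — an odd-sector, two-site local-equilibrium statement) and (2b) the
thermometer bound `|θᶠ − θ*| ≤ C T G_L` (a zero-net-flux probe pair reads the local kinetic
temperature up to `O(current)`). Fails for momentum-conserving chains (kick memory = flight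
length): pinning and `lam, β > 0` must enter here. -/
theorem stub_junctionRoughness :
    ∀ (ω₂ lam β γ : ℝ) (μ : (N : ℕ) → ℝ → ℝ → Measure (PhaseSpace N)) (T : ℝ) (D : ℕ → ℝ),
      CruxFrame ω₂ lam β γ μ T D →
      ∃ C₂ : ℝ, ∀ N M : ℕ, 2 ≤ N → 2 ≤ M →
        ∀ (h : PhaseSpace (N + M) → ℝ) (g : Fin 4 → Fin 4 → ℝ)
          (gb₁ gb₄ : PhaseSpace (N + M) → ℝ),
          PlainFrame (pinnedChain ω₂ lam β γ) T (N + M) h (D (N + M) / ((N : ℝ) + (M : ℝ) - 1)) →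
          DeviceFrame (pinnedChain ω₂ lam β γ) T N M g gb₁ gb₄ →
          roughness (pinnedChain ω₂ lam β γ) T N M (fun x => h x - floatTemp g * eK T N M x) ≤
            C₂ * (D (N + M) / ((N : ℝ) + (M : ℝ) - 1)) ^ 2 := by
  sorry

/-- STUB 3 — JUNCTION CURVATURE OF THE PROBED FORWARD FIELDS (size L–XL).
`‖S_K gb₁‖² ≤ C₃ L₁₁²` and `‖S_K gb₄‖² ≤ C₃ L₄₄²`: the end-bath forward fields of the DEVICE depend
on the junction momenta at the scale of the device's own self-conductances (energy channel:
`gb₁ ≈ Σ_k w_k (e_k − ⟨e_k⟩)` with `w_K ≈ u/γ²`; direction channel smaller). The two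
`p`-derivatives sit at `γ`-noised coordinates of the probed dynamics: unit-time hypoelliptic
smoothing with second-order Malliavin weights at a directly forced coordinate (triage r1-3),
`N`-uniform because the noise acts on `p_K` itself; Lyapunov weights for the cubic drift. -/
theorem stub_junctionCurvature :
    ∀ (ω₂ lam β γ T : ℝ), 0 < ω₂ → 0 < lam → 0 < β → 0 < γ → 0 < T →
      ∃ C₃ : ℝ, ∀ N M : ℕ, 2 ≤ N → 2 ≤ M →
        ∀ (g : Fin 4 → Fin 4 → ℝ) (gb₁ gb₄ : PhaseSpace (N + M) → ℝ),
          DeviceFrame (pinnedChain ω₂ lam β γ) T N M g gb₁ gb₄ →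
          curvature (pinnedChain ω₂ lam β γ) T N M gb₁ ≤ C₃ * selfLeft g ^ 2 ∧
          curvature (pinnedChain ω₂ lam β γ) T N M gb₄ ≤ C₃ * selfRight g ^ 2 := by
  sorry

/-- STUB 4 — TERMINATION LOCALITY, one-sided (size XL; companion card's TL⁺, both ends).
`L₁₁ ≤ G_N (1 + c G_N)` and `L₄₄ ≤ G_M (1 + c G_M)`: attaching anything beyond the γ-bathed site
`N−1` (here: the probe on it, the bond, the probed site `N`, `M−1` more sites and a bath, all at
`T`) raises the self-conductance of the far bath by at most `O(G_N²)` — renewal at a bathed site,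
"double escape" (divider ratio `θ_N = O(G_N)`); only this direction is used (Dirichlet side). -/
theorem stub_terminationLocality :
    ∀ (ω₂ lam β γ : ℝ) (μ : (N : ℕ) → ℝ → ℝ → Measure (PhaseSpace N)) (T : ℝ) (D : ℕ → ℝ),
      CruxFrame ω₂ lam β γ μ T D →
      ∃ c : ℝ, ∀ N M : ℕ, 2 ≤ N → 2 ≤ M →
        ∀ (g : Fin 4 → Fin 4 → ℝ) (gb₁ gb₄ : PhaseSpace (N + M) → ℝ),
          DeviceFrame (pinnedChain ω₂ lam β γ) T N M g gb₁ gb₄ →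
          selfLeft g ≤ D N / ((N : ℝ) - 1) * (1 + c * (D N / ((N : ℝ) - 1))) ∧
          selfRight g ≤ D M / ((M : ℝ) - 1) * (1 + c * (D M / ((M : ℝ) - 1))) := by
  sorry

/-- STUB 5 — FAR TRANSMISSION with its sign (size L–XL; companion card's FT).
`0 ≤ g₁₄ ≤ c G_N G_M`: energy injected at bath 4 reaches bath 1 past two γ-thermostatted sites
with efficiency `O(G_N G_M)`; the lower half (non-negativity of the time-integrated end-to-end
energy–energy correlation past the pair; automatic in the Gaussian corner) is the ONLY sign
statement the composition uses (it pays for `U ≥ min(L₁₁, L₄₄)/2`). -/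
theorem stub_farTransmission :
    ∀ (ω₂ lam β γ : ℝ) (μ : (N : ℕ) → ℝ → ℝ → Measure (PhaseSpace N)) (T : ℝ) (D : ℕ → ℝ),
      CruxFrame ω₂ lam β γ μ T D →
      ∃ c : ℝ, ∀ N M : ℕ, 2 ≤ N → 2 ≤ M →
        ∀ (g : Fin 4 → Fin 4 → ℝ) (gb₁ gb₄ : PhaseSpace (N + M) → ℝ),
          DeviceFrame (pinnedChain ω₂ lam β γ) T N M g gb₁ gb₄ →
          0 ≤ bypass g ∧ bypass g ≤ c * (D N / ((N : ℝ) - 1)) * (D M / ((M : ℝ) - 1)) := by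
  sorry

/-! ## Composition -/

/-- Cauchy–Schwarz bookkeeping of the α-leg: from the squared identity bound and the two size
bets to `Δ ≤ γ²√(C₂⁺C₃⁺)·s·G`. -/
theorem insertion_bound {Δ γ cu ro C₃ C₂ s G : ℝ} (hs : 0 ≤ s) (hG : 0 ≤ G)
    (hro0 : 0 ≤ ro) (h : Δ ^ 2 ≤ γ ^ 4 * cu * ro) (hcu : cu ≤ C₃ * s ^ 2)
    (hro : ro ≤ C₂ * G ^ 2) :
    Δ ≤ γ ^ 2 * Real.sqrt (max C₂ 0 * max C₃ 0) * s * G := by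
  have hcu' : cu ≤ max C₃ 0 * s ^ 2 :=
    hcu.trans (mul_le_mul_of_nonneg_right (le_max_left _ _) (sq_nonneg _))
  have hro' : ro ≤ max C₂ 0 * G ^ 2 :=
    hro.trans (mul_le_mul_of_nonneg_right (le_max_left _ _) (sq_nonneg _))
  have hprod : cu * ro ≤ (max C₃ 0 * s ^ 2) * (max C₂ 0 * G ^ 2) :=
    mul_le_mul hcu' hro' hro0 (by positivity)
  have hγ4 : 0 ≤ γ ^ 4 := by positivity
  have hsq : Real.sqrt (max C₂ 0 * max C₃ 0) ^ 2 = max C₂ 0 * max C₃ 0 :=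
    Real.sq_sqrt (by positivity)
  have h2 : Δ ^ 2 ≤ (γ ^ 2 * Real.sqrt (max C₂ 0 * max C₃ 0) * s * G) ^ 2 := by
    calc Δ ^ 2 ≤ γ ^ 4 * cu * ro := h
      _ = γ ^ 4 * (cu * ro) := by ring
      _ ≤ γ ^ 4 * ((max C₃ 0 * s ^ 2) * (max C₂ 0 * G ^ 2)) :=
          mul_le_mul_of_nonneg_left hprod hγ4
      _ = (γ ^ 2 * Real.sqrt (max C₂ 0 * max C₃ 0) * s * G) ^ 2 := by
          rw [show (γ ^ 2 * Real.sqrt (max C₂ 0 * max C₃ 0) * s * G) ^ 2 =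
              γ ^ 4 * Real.sqrt (max C₂ 0 * max C₃ 0) ^ 2 * s ^ 2 * G ^ 2 by ring, hsq]
          ring
  have hnn : 0 ≤ γ ^ 2 * Real.sqrt (max C₂ 0 * max C₃ 0) * s * G := by positivity
  exact le_trans (le_abs_self Δ) (abs_le_of_sq_le_sq h2 hnn)

/-- COMPOSITION (kernel-checked; the only `sorry`s it depends on are the six registered stubs, used BY
NAME): the crux `JunctionLocality.SuperadditiveResistance` BY NAME, for all `N, M ≥ 2`, with the
constant `C = 4c + 2K + 4K(1+c) + 2`, `K = γ²√(C₂⁺C₃⁺)`, `c = max(c_TL, c_FT, 0)`. Logical shape: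
`stub_linearResponse → stub_insertionIdentity → stub_junctionRoughness → stub_junctionCurvature →
stub_terminationLocality → stub_farTransmission → SuperadditiveResistance` (the skeleton audit wants
the stubs invoked by name rather than re-stated as hypotheses). -/
theorem SuperadditiveResistance_of :
    Summit.AtomisticToContinuum.FouriersLaw.Theses.JunctionLocality.SuperadditiveResistance := by
  have hLR := stub_linearResponse
  have hID := stub_insertionIdentity
  have hRO := stub_junctionRoughness
  have hCU := stub_junctionCurvature
  have hTL := stub_terminationLocality
  have hFT := stub_farTransmission
  intro ω₂ lam β γ hω hl hβ hγ hU μ hμ T hT D hD hpos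
  have hF : CruxFrame ω₂ lam β γ μ T D := ⟨hω, hl, hβ, hγ, hU, hμ, hT, hD, hpos⟩
  obtain ⟨C₂, hC₂⟩ := hRO ω₂ lam β γ μ T D hF
  obtain ⟨C₃, hC₃⟩ := hCU ω₂ lam β γ T hω hl hβ hγ hT
  obtain ⟨c₁, hc₁⟩ := hTL ω₂ lam β γ μ T D hF
  obtain ⟨c₂, hc₂⟩ := hFT ω₂ lam β γ μ T D hF
  obtain ⟨hPlain, hDev⟩ := hLR ω₂ lam β γ μ T D hF
  -- uniform constants
  obtain ⟨c, hc_def⟩ : ∃ c : ℝ, c = max (max c₁ c₂) 0 := ⟨_, rfl⟩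
  obtain ⟨K, hK_def⟩ : ∃ K : ℝ, K = γ ^ 2 * Real.sqrt (max C₂ 0 * max C₃ 0) := ⟨_, rfl⟩
  have hc0 : 0 ≤ c := by rw [hc_def]; exact le_max_right _ _
  have hcc₁ : c₁ ≤ c := by rw [hc_def]; exact le_trans (le_max_left _ _) (le_max_left _ _)
  have hcc₂ : c₂ ≤ c := by rw [hc_def]; exact le_trans (le_max_right _ _) (le_max_left _ _)
  have hK0 : 0 ≤ K := by rw [hK_def]; positivity
  refine ⟨4 * c + 2 * K + 4 * K * (1 + c) + 2, ?_⟩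
  intro N M hN hM
  -- the response field of the whole chain and the device data of this split
  obtain ⟨h, hPF⟩ := hPlain (N + M) (by omega)
  obtain ⟨g, gb₁, gb₄, hDF⟩ := hDev N M hN hM
  have hcast : ((N + M : ℕ) : ℝ) - 1 = (N : ℝ) + (M : ℝ) - 1 := by push_cast; ring
  rw [hcast] at hPF
  -- conductances of the whole and of the pieces
  obtain ⟨gL, hgL⟩ : ∃ gL : ℝ, gL = D (N + M) / ((N : ℝ) + (M : ℝ) - 1) := ⟨_, rfl⟩
  obtain ⟨gN, hgN⟩ : ∃ gN : ℝ, gN = D N / ((N : ℝ) - 1) := ⟨_, rfl⟩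
  obtain ⟨gM, hgM⟩ : ∃ gM : ℝ, gM = D M / ((M : ℝ) - 1) := ⟨_, rfl⟩
  have hN' : (2 : ℝ) ≤ (N : ℝ) := by exact_mod_cast hN
  have hM' : (2 : ℝ) ≤ (M : ℝ) := by exact_mod_cast hM
  have hgN0 : 0 < gN := by rw [hgN]; exact div_pos (hpos N hN) (by linarith)
  have hgM0 : 0 < gM := by rw [hgM]; exact div_pos (hpos M hM) (by linarith)
  have hgL0 : 0 < gL := by rw [hgL]; exact div_pos (hpos (N + M) (by omega)) (by linarith)
  have hrough := hC₂ N M hN hM h g gb₁ gb₄ hPF hDF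
  rw [← hgL] at hPF hrough
  have hsym : ∀ a b, g a b = g b a := hDF.2.2.1
  have hpsd : ∀ θ, 0 ≤ dirichletForm g θ := hDF.2.2.2.1
  have ha0 : 0 ≤ selfLeft g := selfLeft_nonneg hsym hpsd
  have hb0 : 0 ≤ selfRight g := selfRight_nonneg hsym hpsd
  -- α-LEG: the identity at the floating temperature, from both ends, with the two size bets
  obtain ⟨h1, h4⟩ :=
    hID ω₂ lam β γ T hω hl hβ hγ hT N M hN hM h gL g gb₁ gb₄ hPF hDF (floatTemp g)
  obtain ⟨hcurv₁, hcurv₄⟩ := hC₃ N M hN hM g gb₁ gb₄ hDF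
  have hro0 : 0 ≤ roughness (pinnedChain ω₂ lam β γ) T N M
      (fun x => h x - floatTemp g * eK T N M x) := integral_nonneg fun _ => sq_nonneg _
  have hα₁ : gL - deviceConductance g ≤ K * selfLeft g * gL := by
    rw [hK_def]
    refine insertion_bound ha0 hgL0.le hro0 ?_ hcurv₁ hrough
    calc (gL - deviceConductance g) ^ 2 = (sideOne g (floatTemp g) - gL) ^ 2 := by
          unfold deviceConductance; ring
      _ ≤ _ := h1
  have hα₄ : gL - deviceConductance g ≤ K * selfRight g * gL := by
    rw [hK_def]
    refine insertion_bound hb0 hgL0.le hro0 ?_ hcurv₄ hrough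
    calc (gL - deviceConductance g) ^ 2 = (sideFour g (floatTemp g) - gL) ^ 2 := by
          rw [sideFour_floatTemp hsym hpsd]; ring
      _ ≤ _ := h4
  have hα : gL - deviceConductance g ≤ K * min (selfLeft g) (selfRight g) * gL := by
    rcases min_choice (selfLeft g) (selfRight g) with hmin | hmin <;> rw [hmin]
    · exact hα₁
    · exact hα₄
  -- β-LEG: the Dirichlet principle and the one-sided termination/transmission bets
  have hDir := deviceConductance_le hsym hpsd
  obtain ⟨hTLa, hTLb⟩ := hc₁ N M hN hM g gb₁ gb₄ hDF
  obtain ⟨hx0, hxup⟩ := hc₂ N M hN hM g gb₁ gb₄ hDF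
  rw [← hgN] at hTLa hxup
  rw [← hgM] at hTLb hxup
  have ha : selfLeft g ≤ gN * (1 + c * gN) :=
    hTLa.trans (mul_le_mul_of_nonneg_left
      ((add_le_add_iff_left 1).mpr (mul_le_mul_of_nonneg_right hcc₁ hgN0.le)) hgN0.le)
  have hb : selfRight g ≤ gM * (1 + c * gM) :=
    hTLb.trans (mul_le_mul_of_nonneg_left
      ((add_le_add_iff_left 1).mpr (mul_le_mul_of_nonneg_right hcc₁ hgM0.le)) hgM0.le)
  have hx : bypass g ≤ c * gN * gM :=
    hxup.trans (mul_le_mul_of_nonneg_right (mul_le_mul_of_nonneg_right hcc₂ hgN0.le) hgM0.le)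
  -- the real-analysis core
  have key := core_estimate hgN0 hgM0 hgL0 hK0 hc0 ha0 hb0 hx0 ha hb hx hα hDir
  rw [hgN, hgM, hgL, one_div_div, one_div_div, one_div_div] at key
  exact key

end Summit.AtomisticToContinuum.FouriersLaw.Cruxes.SuperadditiveResistance.ThermaliseThenCutProbeInsertion
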